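import Literature.NumberTheory.EllipticCurves.Rank1Residual.PrintShape
import Literature.NumberTheory.EllipticCurves.Rank1Residual.Predicates
import Literature.NumberTheory.EllipticCurves.Rank1Residual.Typed.X6
import Literature.NumberTheory.EllipticCurves.Rank1Residual.Typed.X8
import HarnessLib

/-!
# Castella–Çiperiani–Skinner–Sprung (arXiv:1804.10993v2, PREPRINT since 2018), Thms. C and D: the ANNOUNCED `p`-part of BSD at good NON-ORDINARY primes of semistable curves (any `a_p` with `p ∣ a_p`, so `p = 3`, `a_3 = ±3` included) — as an explicitly labelled OPEN hypothesis, and the conditional theorem for class X8 ∩ {semistable}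

HONEST FRAMING (cell `b2b-bsdres`, run/shared/lean/b2b/bsd-rank1-residual/; harvest seat
`b2b-bsdres-harvest-1`): prove what is provable now; shrink each hard class to its core with data;
no claim beyond stated classes. PUBLISHED theorems only delete classes; an ANNOUNCED preprint
enters only as an explicitly labelled OPEN hypothesis, NEVER as a theorem; construction-shaped
classes are typed, not attempted; this is not "finishing BSD".

Class X8 of RESIDUAL-CASES §a.2 (`Rank1Residual.ClassX8 W p := p = 3 ∧ GoodSS W 3 ∧ a_3 ≠ 0`:
the only supersingular case with `a_p ≠ 0`; both ranks, semistable or not) is CONSTRUCTION-SHAPED;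
RESIDUAL-CASES v5 records "r = 0 ∧ sst: Sprung, Adv. Math. 449 (2024) — CONDITIONAL on his
Conj. 3.33; r = 1: OPEN/unclear". The harvest (HOME/b2b-bsdres-harvest-1/HARVEST.md row S13) found
that the SEMISTABLE part of X8 carries an ANNOUNCED `p`-part statement in BOTH ranks, unrefereed
since 2018: Thms. C/D below (GL₂-type `A`, `p ∤ N` good non-ordinary — "`|ı_p(a_p)|_p < 1`", no
`a_p = 0` requirement —, `A` without rational isogenies of `p`-power degree). This file types it
exactly as printed as ONE OPEN `Prop` and derives the conditional class statement; nothing is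
asserted. (Pattern: `KellerYin2024/AnomalousBSD.lean` for X1a; the companion file
`BurungaleSkinnerTianWan2024/SupersingularPPartOPEN.lean` does the same for X6, whose BSTW
statement needs `a_3 = 0` at `p = 3` and so never reaches X8.)

Source (read: `paper:arxiv-1804.10993` chunks p0003–p0005; v2 of 2018; Crossref 2026-08-19: no
journal version). F. Castella, M. Çiperiani, C. Skinner, F. Sprung, *On the Iwasawa main conj[.]s
for modular forms at non-ordinary primes* [CastellaCiperianiSkinnerSprung2018]. Setting (§1.1):
"`f ∈ S₂^new(Γ₀(N))` a newform of weight 2 and trivial nebentypus. Let `p > 2` be a prime … Assume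
that `p` is a good prime for `f`, i.e., `p ∤ N`, and non-ordinary in the sense that
`|ı_p(a_p)|_p < 1`." Verbatim:

> **Theorem C.** Let `A/ℚ` be a semistable abelian variety of GL₂-type of conductor `N`, associated
> with a newform `f ∈ S₂(Γ₀(N))`, let `p ∤ N` be a prime of good reduction for `A`, and assume that
> `A` has no rational isogenies of `p`-power degree. If `L(A,1) ≠ 0`, then for every prime `𝔓` of
> `K_f` above `p` we have `ord_𝔓(L(A,1)/Ω_A) = ord_𝔓(#Ш(A/ℚ) ∏_{ℓ∣N} c_ℓ(A/ℚ))`, where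
> `Ω_A = ∫_{A(ℝ)} |ω_A|`, for `ω_A` a Néron differential, is the real period of `A`, `Ш(A/ℚ)` is the
> Tate–Shafarevich group of `A`, and `c_ℓ(A/ℚ)` is the Tamagawa number of `A` at the prime `ℓ`. In
> other words, the `p`-part of the Birch–Swinnerton-Dyer formula holds for `A`.
> **Theorem D.** [same hypotheses] If `ord_{s=1} L(f,s) = 1`, then for every prime `𝔓` of `K_f`
> above `p` we have `ord_𝔓(L^*(A,1)/(Reg(A/ℚ)·Ω_A)) = ord_𝔓(#Ш(A/ℚ) ∏_{ℓ∣N} c_ℓ(A/ℚ))`, where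
> `L^*(A,1)` is the leading term of the Taylor series expansion of `L(A,s)` around `s = 1`, and
> `Reg(A/ℚ)` is the discriminant of the Néron–Tate canonical height pairing on `A(ℚ) ⊗ ℝ`.

(The theorems are stated for every good `p > 2` of a non-ordinary newform — the standing hypothesis
of §1.1; for an elliptic curve, `K_f = ℚ`, `𝔓 = p`, and "no rational isogenies of `p`-power degree"
⇔ no rational `p`-isogeny ⇔ `E[p]` irreducible. Printed inputs: the signed main conj[.]s Thm. A
(via Thm. B over an auxiliary imaginary quadratic field, Büyükboduk–Lei, Wan's [wan-combined] =
arXiv:1411.6352 — since withdrawn, BSTW Rem. 1.4 (i) —, Sprung's [sprung-IMC]), Mazur's control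
theorem for signed Selmer groups, and for Thm. D the anticyclotomic BDP main conj[.] + "an extension
of the arguments in [JSW]".)

Transcription for an elliptic curve (tree dictionary of `BSDRootNumberSmallConductorProofs`,
`Rank1Residual.Predicates`, `Rank1Residual.PrintShape`): `W` globally minimal (`W.realPeriodRat =
Ω_A`, `W.frobeniusTrace p = a_p`); "`p > 2` good non-ordinary" = `p ≠ 2 ∧ GoodSS W p` (good, `p ∣ a_p`
— at `p = 3` this ALLOWS `a_3 = ±3`); "semistable" = `Semistable W`; "no rational `p`-isogeny" =
`Irr W p`; Thm. C: `W.analyticRank = 0` ⇒ `L(E,1)/Ω = q ∈ ℚ` with `ord_p q = ord_p #Ш + ord_p ∏ c_ℓ`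
(the cell's rank-zero no-torsion shape, `bsdp_of_padicVal_printShape_rankZero`); Thm. D:
`W.analyticRank = 1` ⇒ `L'(E,1)/(Ω·Reg) = q ∈ ℚ` with the same valuation (the no-torsion shape,
`bsdp_of_padicVal_printShape`; `L^*(A,1) = W.leadingLCoeff` in rank one). `#Ш = W.shaOrder`
(finite in analytic rank `≤ 1`, GZK). The GL₂-type generality is not transcribed.
-- TODO(general form): abelian varieties of GL₂-type / primes 𝔓 of K_f, once the tree has them.

STATUS of the binder: PRE (announced 2018, unrefereed; two of its own inputs are preprints). The
conditional theorem `X8.bsdp_of_thmCD_OPEN` records what the closure of X8 ∩ {semistable} is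
conditional on; it closes nothing. X8 ∧ ¬semistable has not even an announced statement.
APPEND (harvest seat 1 GEN 8): the `Irr W p` binder of the two conditional theorems is AUTOMATIC —
Serre 1972 §1.11 Prop. 12 at an odd supersingular prime is a tree THEOREM
(`hasIrreducibleModPGaloisRep_of_dvd_frobeniusTrace`; on the classes `Rank1Residual.ClassX8.irr'`,
`Rank1Residual.ClassX6.irr`) — primed versions `X8.bsdp_of_thmCD_OPEN'`, `X6.bsdp_of_thmCD_OPEN'`
drop it: granted the OPEN binder and GZK, `BSD(E,3)` at every SEMISTABLE X8 pair and `BSD(E,p)` at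
every X6 pair with `p ≠ 2`, in analytic rank `≤ 1`, no further hypothesis. Conditional; closes nothing.

## References
* [CastellaCiperianiSkinnerSprung2018] arXiv:1804.10993v2, §1.1 (setting), Thms. A–D, Rem. 1.2, 1.5.
* [Sprung2012] F. Sprung, J. Number Theory 132 (2012) (♯/♭ Selmer groups and signed p-adic L-functions for a_p ≠ 0).
* [BurungaleSkinnerTianWan2024] Rem. 1.4 (i) (status of [wan-combined]).
* RESIDUAL-CASES.md §a.2 X8; CLASSES.md X8; `Rank1Residual/Typed/X8.lean`; HARVEST.md S13.
-/

set_option autoImplicit false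

noncomputable section

open scoped Classical

open WeierstrassCurve Literature.NumberTheory.EllipticCurves
  Literature.NumberTheory.EllipticCurves.Rank1Residual

namespace Literature.NumberTheory.EllipticCurves.CastellaCiperianiSkinnerSprung2018

/-- **OPEN HYPOTHESIS — UNREFEREED PREPRINT (arXiv:1804.10993v2, 2018), Thms. C and D** for an
elliptic curve `E/ℚ`: "Let `A/ℚ` be a semistable abelian variety of GL₂-type of conductor `N` …
let `p ∤ N` be a prime of good reduction for `A` [§1.1: `p > 2`, non-ordinary, `|ı_p(a_p)|_p < 1`],
and assume that `A` has no rational isogenies of `p`-power degree. [C] If `L(A,1) ≠ 0`, then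
`ord_𝔓(L(A,1)/Ω_A) = ord_𝔓(#Ш(A/ℚ) ∏_{ℓ∣N} c_ℓ(A/ℚ))`. [D] If `ord_{s=1} L(f,s) = 1`, then
`ord_𝔓(L^*(A,1)/(Reg(A/ℚ)·Ω_A)) = ord_𝔓(#Ш(A/ℚ) ∏_{ℓ∣N} c_ℓ(A/ℚ))`." Transcribed for a globally
minimal `W`: `p ≠ 2`, `Semistable W`, `GoodSS W p` (good, `p ∣ a_p`; at `p = 3` the case
`a_3 = ±3` IS included), `Irr W p` ⇒ (r_an = 0 → rank-zero no-torsion shape) ∧ (r_an = 1 →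
no-torsion shape with the regulator). NEVER cite this `Prop` as a theorem; take it as an explicit
hypothesis (the announced statement covering class X8 ∩ {semistable} in both ranks).
[claim: CastellaCiperianiSkinnerSprung2018, status: under-review] -/
def thmCD_pPart_OPEN : Prop :=
  ∀ (W : WeierstrassCurve ℚ) [W.IsElliptic] [W.IsGloballyMinimal] (p : ℕ) [Fact p.Prime],
    p ≠ 2 → Semistable W → GoodSS W p → Irr W p →
      (W.analyticRank = 0 →
        ∃ q : ℚ, W.entireLFunction 1 / (W.realPeriodRat : ℂ) = (q : ℂ) ∧
          padicValRat p q = (padicValNat p W.shaOrder : ℤ) + padicValNat p W.tamagawaProduct) ∧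
      (W.analyticRank = 1 →
        ∃ q : ℚ, W.leadingLCoeff / ((W.realPeriodRat * W.regulator : ℝ) : ℂ) = (q : ℂ) ∧
          padicValRat p q = (padicValNat p W.shaOrder : ℤ) + padicValNat p W.tamagawaProduct)

/-- **X8 ∩ {semistable}: conditional class theorem (announced statement as an OPEN binder).** IF the
announced Thms. C/D of Castella–Çiperiani–Skinner–Sprung (`hCCSS_OPEN`, unrefereed since 2018)
hold, then at every X8 pair (`p = 3`, good supersingular, `a_3 = ±3`) of a SEMISTABLE curve with
`E[3]` irreducible (`hirr`; automatic at a supersingular `3`, not yet a tree lemma) and analytic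
rank `≤ 1`, Miller's `BSD(E,3)` follows via the cell's bridges `bsdp_of_padicVal_printShape_rankZero`
/ `bsdp_of_padicVal_printShape` (GZK `hGZK`). CONDITIONAL; closes nothing; X8 ∧ ¬semistable is not
reached even by the announcement. [claim: CastellaCiperianiSkinnerSprung2018, status: under-review] [cite: Miller2011LMS, §1 and Def. 1.1] -/
theorem X8.bsdp_of_thmCD_OPEN (hCCSS_OPEN : thmCD_pPart_OPEN)
    (hGZK : rank_eq_analyticRank_of_analyticRank_le_one)
    (W : WeierstrassCurve ℚ) [W.IsElliptic] [W.IsGloballyMinimal] (p : ℕ) [Fact p.Prime]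
    (hX : ClassX8 W p) (hsst : Semistable W) (hirr : Irr W p) (hr : W.analyticRank ≤ 1) :
    BSDp W p := by
  obtain ⟨hp3, hss, _⟩ := hX
  subst hp3
  obtain ⟨h0, h1⟩ := hCCSS_OPEN W 3 (by decide) hsst hss hirr
  rcases Nat.lt_or_ge W.analyticRank 1 with hlt | hge
  · have hr0 : W.analyticRank = 0 := by omega
    exact bsdp_of_padicVal_printShape_rankZero W 3 hGZK hr0 hirr (h0 hr0)
  · have hr1 : W.analyticRank = 1 := le_antisymm hr hge
    exact bsdp_of_padicVal_printShape W 3 hGZK hr hirr (h1 hr1)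

/-- The same announcement reaches the semistable supersingular class X6 at EVERY `p > 2` with
`p ∣ a_p`, without the "(h4) `a_3 = 0`" proviso of Burungale–Skinner–Tian–Wan — in particular also
X6 at `p = 3` (where `ClassX6` itself demands `a_3 = 0`). Conditional on the same OPEN binder;
closes nothing. [claim: CastellaCiperianiSkinnerSprung2018, status: under-review] [cite: Miller2011LMS, §1 and Def. 1.1] -/
theorem X6.bsdp_of_thmCD_OPEN (hCCSS_OPEN : thmCD_pPart_OPEN)
    (hGZK : rank_eq_analyticRank_of_analyticRank_le_one)
    (W : WeierstrassCurve ℚ) [W.IsElliptic] [W.IsGloballyMinimal] (p : ℕ) [Fact p.Prime]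
    (hp : p ≠ 2) (hX : ClassX6 W p) (hirr : Irr W p) (hr : W.analyticRank ≤ 1) : BSDp W p := by
  obtain ⟨h0, h1⟩ := hCCSS_OPEN W p hp hX.2.1 hX.1 hirr
  rcases Nat.lt_or_ge W.analyticRank 1 with hlt | hge
  · have hr0 : W.analyticRank = 0 := by omega
    exact bsdp_of_padicVal_printShape_rankZero W p hGZK hr0 hirr (h0 hr0)
  · have hr1 : W.analyticRank = 1 := le_antisymm hr hge
    exact bsdp_of_padicVal_printShape W p hGZK hr hirr (h1 hr1)

/-! ### APPEND (harvest seat 1 GEN 8): the (irr) binders are automatic — Serre 1972 §1.11 Prop. 12,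
PROVED in the tree -/

/-- **X8 ∩ {semistable}: conditional class theorem, NO (irr) binder.** IF the announced Thms. C/D of
Castella–Çiperiani–Skinner–Sprung (`hCCSS_OPEN`, unrefereed) hold, then at EVERY X8 pair of a
semistable curve in analytic rank `≤ 1`, Miller's `BSD(E,3)` follows (GZK `hGZK`); `E[3]` is
irreducible by Serre's Prop. 12 at the odd supersingular prime `3` (`Rank1Residual.ClassX8.irr'`).
CONDITIONAL; closes nothing. [claim: CastellaCiperianiSkinnerSprung2018, status: under-review] [cite: Serre1972, §1.11 Prop. 12] [cite: Miller2011LMS, §1 and Def. 1.1] -/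
theorem X8.bsdp_of_thmCD_OPEN' (hCCSS_OPEN : thmCD_pPart_OPEN)
    (hGZK : rank_eq_analyticRank_of_analyticRank_le_one)
    (W : WeierstrassCurve ℚ) [W.IsElliptic] [W.IsGloballyMinimal] (p : ℕ) [Fact p.Prime]
    (hX : ClassX8 W p) (hsst : Semistable W) (hr : W.analyticRank ≤ 1) : BSDp W p :=
  X8.bsdp_of_thmCD_OPEN hCCSS_OPEN hGZK W p hX hsst (ClassX8.irr' W p hX) hr

/-- **X6: conditional class theorem from the CCSS announcement, NO (irr) binder** (every `p > 2`
with `p ∣ a_p`, no (h4) proviso; `E[p]` irreducible by `Rank1Residual.ClassX6.irr`). CONDITIONAL;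
closes nothing. [claim: CastellaCiperianiSkinnerSprung2018, status: under-review] [cite: Serre1972, §1.11 Prop. 12] [cite: Miller2011LMS, §1 and Def. 1.1] -/
theorem X6.bsdp_of_thmCD_OPEN' (hCCSS_OPEN : thmCD_pPart_OPEN)
    (hGZK : rank_eq_analyticRank_of_analyticRank_le_one)
    (W : WeierstrassCurve ℚ) [W.IsElliptic] [W.IsGloballyMinimal] (p : ℕ) [Fact p.Prime]
    (hp : p ≠ 2) (hX : ClassX6 W p) (hr : W.analyticRank ≤ 1) : BSDp W p :=
  X6.bsdp_of_thmCD_OPEN hCCSS_OPEN hGZK W p hp hX (ClassX6.irr W p hp hX) hr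

end Literature.NumberTheory.EllipticCurves.CastellaCiperianiSkinnerSprung2018
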